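import Literature.MathematicalPhysics.KineticTheory.CollisionTubeVarianceStaticsSharp
import Literature.MathematicalPhysics.KineticTheory.HardSphereDecoratedPairSumVarianceWindow
import HarnessLib

/-!
# The variance of the decorated tube sum, sharp in the window, under the WINDOWED decorrelation plateau

Topic `Literature/MathematicalPhysics/KineticTheory` (kind proof; windowed twin of
`CollisionTubeVarianceStaticsSharp.variance_prod_decoratedTubeSum_le_sharp`).  The decorated pair-pair decorrelation hypothesis
is assumed only for displacement sets inside the near-contact shell `{ε < ‖reprSym d‖ ≤ ε(1+2Lκ)}` (the support of the
velocity-averaged tube mark) — the form delivered by the windowed plateau `PlateauWindow` of the rung-0 closures — via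
`variance_decoratedPairSum_le_window`; conclusion and proof otherwise verbatim.

References: C. Cercignani, R. Illner, M. Pulvirenti (1994) §2.2 [CIPDiluteGases1994]; D. Ruelle (1969) §4.2 [Ruelle1969]. [folklore]
-/

noncomputable section

namespace Literature.MathematicalPhysics.KineticTheory

open MeasureTheory ProbabilityTheory Set Filter Function
open scoped ENNReal InnerProductSpace BigOperators
open Literature.Analysis.FluidPDE Literature.Probability.Moments

/-- **Variance of the decorated tube sum under `P_N ⊗ γ^{⊗(N+1)}`, sharp in the window, WINDOWED plateau**: as
`variance_prod_decoratedTubeSum_le_sharp`, with the decorrelation hypothesis only for sets inside the near-contact shell. [folklore] -/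
theorem variance_prod_decoratedTubeSum_le_sharp_window {σ : ℝ} (hsd : SmallDensity uniformProfile σ) {N : ℕ} (hN : 1 ≤ N)
    {Ξ : V3 × V3 × V3 → ℝ} (hΞm : Measurable Ξ) {C L κ : ℝ} (hCpos : 0 < C) (hC : ∀ p, |Ξ p| ≤ C) (hL : 0 ≤ L) (hκ : 0 ≤ κ)
    (hΞL : ∀ m v v' : V3, 2 * L ≤ ‖v - v'‖ → Ξ (m, v, v') = 0) (hεL : hsDiameter σ N * (1 + 2 * L * κ) < 1 / 2)
    {h : T3 → ℝ} (hh : Measurable h) (hh1 : ∀ y, |h y| ≤ 1) (γ : Measure V3) [IsProbabilityMeasure γ]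
    {ζ : ℝ} (hζ : 0 ≤ ζ)
    (hdec : ∀ i j i' j' : Fin (N + 1), i ≠ j → i ≠ i' → i ≠ j' → j ≠ i' → j ≠ j' → i' ≠ j' →
      ∀ T T' : Set T3, MeasurableSet T → MeasurableSet T' →
      T ⊆ {d : T3 | hsDiameter σ N < ‖Torus.reprSym d‖ ∧ ‖Torus.reprSym d‖ ≤ hsDiameter σ N * (1 + 2 * L * κ)} →
      T' ⊆ {d : T3 | hsDiameter σ N < ‖Torus.reprSym d‖ ∧ ‖Torus.reprSym d‖ ≤ hsDiameter σ N * (1 + 2 * L * κ)} →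
      |(∫ x, h (x i) * T.indicator (fun _ => (1 : ℝ)) (x j - x i) * (h (x i') * T'.indicator (fun _ => (1 : ℝ)) (x j' - x i'))
          ∂posGibbsMeasure (fun _ : T3 => (1 : ℝ)) (hsDiameter σ N) (N + 1)) -
        (∫ x, h (x i) * T.indicator (fun _ => (1 : ℝ)) (x j - x i) ∂posGibbsMeasure (fun _ : T3 => (1 : ℝ)) (hsDiameter σ N) (N + 1)) *
        (∫ x, h (x i') * T'.indicator (fun _ => (1 : ℝ)) (x j' - x i') ∂posGibbsMeasure (fun _ : T3 => (1 : ℝ)) (hsDiameter σ N) (N + 1))|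
        ≤ ζ * (volume T).toReal * (volume T').toReal) :
    variance (fun p : (Fin (N + 1) → T3) × (Fin (N + 1) → V3) =>
        ∑ i, ∑ j, if i ≠ j then h (p.1 i) * pairTubeMark (hsDiameter σ N) κ Ξ i j p.1 p.2 else 0)
      ((posGibbsMeasure (fun _ : T3 => (1 : ℝ)) (hsDiameter σ N) (N + 1)).prod (Measure.pi fun _ : Fin (N + 1) => γ)) ≤
      64 * C ^ 2 * (3 + 4 * L * κ) ^ 3 * ((N + 1 : ℕ) : ℝ) ^ 2 *
          (4 / 3 * Real.pi * ((hsDiameter σ N * (1 + 2 * L * κ)) ^ 3 - hsDiameter σ N ^ 3)) +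
        2 * (((N + 1 : ℕ) : ℝ) ^ 2 * (16 * C ^ 2 * (4 / 3 * Real.pi * ((hsDiameter σ N * (1 + 2 * L * κ)) ^ 3 - hsDiameter σ N ^ 3)) +
          96 * ((N + 1 : ℕ) : ℝ) * C ^ 2 * (4 / 3 * Real.pi * ((hsDiameter σ N * (1 + 2 * L * κ)) ^ 3 - hsDiameter σ N ^ 3)) ^ 2 +
          4 * ζ * ((N + 1 : ℕ) : ℝ) ^ 2 * C ^ 2 *
            (4 / 3 * Real.pi * ((hsDiameter σ N * (1 + 2 * L * κ)) ^ 3 - hsDiameter σ N ^ 3)) ^ 2)) := by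
  have hσ := hsd.σ_pos
  have hε := hsDiameter_pos hσ N
  haveI := isProbabilityMeasure_posGibbsMeasure continuous_const (fun _ => one_pos) hsd.σ_lt_half.le N
  set P := posGibbsMeasure (fun _ : T3 => (1 : ℝ)) (hsDiameter σ N) (N + 1) with hP
  set Q : Measure (Fin (N + 1) → V3) := Measure.pi fun _ : Fin (N + 1) => γ with hQ
  set vS : ℝ := 4 / 3 * Real.pi * ((hsDiameter σ N * (1 + 2 * L * κ)) ^ 3 - hsDiameter σ N ^ 3) with hvS
  set S : (Fin (N + 1) → T3) × (Fin (N + 1) → V3) → ℝ := fun p =>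
    ∑ i, ∑ j, if i ≠ j then h (p.1 i) * pairTubeMark (hsDiameter σ N) κ Ξ i j p.1 p.2 else 0 with hS
  have hSm : Measurable S := measurable_decoratedTubeSum (hsDiameter σ N) κ hΞm hh
  have hC0 : 0 ≤ C := hCpos.le
  have hterm : ∀ (p : (Fin (N + 1) → T3) × (Fin (N + 1) → V3)) i j,
      |(if i ≠ j then h (p.1 i) * pairTubeMark (hsDiameter σ N) κ Ξ i j p.1 p.2 else 0)| ≤ C := fun p i j => by
    split_ifs
    · rw [abs_mul]
      exact (mul_le_mul (hh1 _) (abs_pairTubeMark_le _ κ hC i j p.1 p.2) (abs_nonneg _) zero_le_one).trans_eq (one_mul _)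
    · rw [abs_zero]; exact hC0
  have hSb : ∀ p, |S p| ≤ (N + 1 : ℕ) * ((N + 1 : ℕ) * C) := fun p => by
    refine (Finset.abs_sum_le_sum_abs _ _).trans ?_
    calc ∑ i, |∑ j, (if i ≠ j then h (p.1 i) * pairTubeMark (hsDiameter σ N) κ Ξ i j p.1 p.2 else 0)|
        ≤ ∑ _i : Fin (N + 1), ((N + 1 : ℕ) * C) := Finset.sum_le_sum fun i _ =>
          (Finset.abs_sum_le_sum_abs _ _).trans ((Finset.sum_le_sum fun j _ => hterm p i j).trans (by
            rw [Finset.sum_const, Finset.card_univ, Fintype.card_fin, nsmul_eq_mul]))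
      _ = (N + 1 : ℕ) * ((N + 1 : ℕ) * C) := by
          rw [Finset.sum_const, Finset.card_univ, Fintype.card_fin, nsmul_eq_mul]
  -- law of total variance
  have hsplit := variance_prod_le P Q hSm hSb
  -- the shell and its volume
  set D : Set T3 := {d : T3 | hsDiameter σ N < ‖Torus.reprSym d‖ ∧ ‖Torus.reprSym d‖ ≤ hsDiameter σ N * (1 + 2 * L * κ)}
    with hD
  have hv : (volume D).toReal ≤ vS := volume_real_torusShell_window_le hε.le hL hκ hεL
  have hv0 : 0 ≤ (volume D).toReal := ENNReal.toReal_nonneg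
  -- (i) the velocity variance, integrated over the positions
  have h1 : ∫ x, variance (fun v => S (x, v)) Q ∂P ≤ 32 * C ^ 2 * (3 + 4 * L * κ) ^ 3 * ((N + 1 : ℕ) : ℝ) ^ 2 * vS := by
    have hae : ∀ᵐ x ∂P, variance (fun v => S (x, v)) Q ≤
        8 * C ^ 2 * (3 + 4 * L * κ) ^ 3 * ∑ m, shellCount σ N L κ (zipConfig (x, fun _ => (0 : V3))) m := by
      filter_upwards [ae_mem_posDomain (fun _ : T3 => (1 : ℝ)) (hsDiameter σ N) (N + 1)] with x hx
      exact variance_pi_decoratedTubeSum_le_shellCount hσ hΞm hC hL hκ hΞL hh1 γ hx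
    have hscm : Measurable fun x : Fin (N + 1) → T3 => ∑ m, shellCount σ N L κ (zipConfig (x, fun _ => (0 : V3))) m := by
      refine Finset.measurable_sum _ fun m _ => Finset.measurable_sum _ fun l _ => ?_
      simp_rw [shellInd_zipConfig_eq_indicator L κ _ (fun _ => (0 : V3)) m l]
      exact measurable_const.indicator
        ((measurableSet_torusShell _ _).preimage ((measurable_pi_apply m).sub (measurable_pi_apply l)))
    have hscb : ∀ x : Fin (N + 1) → T3, |∑ m, shellCount σ N L κ (zipConfig (x, fun _ => (0 : V3))) m| ≤
        (N + 1 : ℕ) * ((N + 1 : ℕ) * (1 : ℝ)) := fun x => by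
      have h0 : 0 ≤ ∑ m, shellCount σ N L κ (zipConfig (x, fun _ => (0 : V3))) m :=
        Finset.sum_nonneg fun m _ => Finset.sum_nonneg fun b _ => shellInd_nonneg L κ _ m b
      rw [abs_of_nonneg h0]
      calc ∑ m, shellCount σ N L κ (zipConfig (x, fun _ => (0 : V3))) m
          ≤ ∑ _m : Fin (N + 1), ((N + 1 : ℕ) * (1 : ℝ)) := Finset.sum_le_sum fun m _ => by
            unfold shellCount
            exact (Finset.sum_le_sum fun l _ => shellInd_le_one L κ _ m l).trans (by
              rw [Finset.sum_const, Finset.card_univ, Fintype.card_fin, nsmul_eq_mul])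
        _ = (N + 1 : ℕ) * ((N + 1 : ℕ) * (1 : ℝ)) := by
            rw [Finset.sum_const, Finset.card_univ, Fintype.card_fin, nsmul_eq_mul]
    have hsci : Integrable (fun x : Fin (N + 1) → T3 =>
        8 * C ^ 2 * (3 + 4 * L * κ) ^ 3 * ∑ m, shellCount σ N L κ (zipConfig (x, fun _ => (0 : V3))) m) P :=
      (Integrable.of_bound hscm.aestronglyMeasurable _
        (ae_of_all _ fun x => (Real.norm_eq_abs _).trans_le (hscb x))).const_mul _
    calc ∫ x, variance (fun v => S (x, v)) Q ∂P
        ≤ ∫ x, 8 * C ^ 2 * (3 + 4 * L * κ) ^ 3 * ∑ m, shellCount σ N L κ (zipConfig (x, fun _ => (0 : V3))) m ∂P :=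
          integral_mono_of_nonneg (ae_of_all _ fun x => variance_nonneg _ _) hsci hae
      _ = 8 * C ^ 2 * (3 + 4 * L * κ) ^ 3 * ∫ x, (∑ m, shellCount σ N L κ (zipConfig (x, fun _ => (0 : V3))) m) ∂P :=
          integral_const_mul _ _
      _ ≤ 8 * C ^ 2 * (3 + 4 * L * κ) ^ 3 * (((N + 1 : ℕ) : ℝ) ^ 2 * (4 * (volume D).toReal)) :=
          mul_le_mul_of_nonneg_left (integral_sum_shellCount_le hsd hN L κ) (by positivity)
      _ ≤ 8 * C ^ 2 * (3 + 4 * L * κ) ^ 3 * (((N + 1 : ℕ) : ℝ) ^ 2 * (4 * vS)) := by gcongr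
      _ = 32 * C ^ 2 * (3 + 4 * L * κ) ^ 3 * ((N + 1 : ℕ) : ℝ) ^ 2 * vS := by ring
  -- (ii) the conditional mean is the decorated pair sum with the velocity-averaged tube mark
  set φ : T3 → ℝ := fun d => ∫ p, tubeMark κ Ξ ((hsDiameter σ N)⁻¹ • Torus.reprSym (-d)) p.1 p.2 ∂(γ.prod γ) with hφ
  have hmean : (fun x => ∫ v, S (x, v) ∂Q) = fun x => ∑ i, ∑ j, if i ≠ j then h (x i) * φ (x j - x i) else 0 := by
    funext x
    exact integral_pi_decoratedTubeSum (hsDiameter σ N) κ hΞm hC h γ x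
  have hφm : Measurable φ := measurable_velAvg_tubeMark (hsDiameter σ N) κ hΞm γ
  have hφB : ∀ d, |φ d| ≤ C := fun d => abs_velAvg_tubeMark_le_of_bound hC (hsDiameter σ N) κ γ d
  have hφD : ∀ d, φ d ≠ 0 → d ∈ D := fun d hd => mem_torusShell_of_velAvg_ne_zero_of_speedCutoff hκ hε hΞL γ d hd
  have hDm : MeasurableSet D := measurableSet_torusShell (hsDiameter σ N) _
  have hDs : ∀ d, d ∈ D ↔ -d ∈ D := fun d => mem_torusShell_iff_neg_mem (hsDiameter σ N) _ d
  have h2 := variance_decoratedPairSum_le_window hsd hN hh hh1 hφm hCpos hφB hDm hDs hφD hζ hdec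
  have h2' : variance (fun x => ∫ v, S (x, v) ∂Q) P ≤
      ((N + 1 : ℕ) : ℝ) ^ 2 * (16 * C ^ 2 * vS + 96 * ((N + 1 : ℕ) : ℝ) * C ^ 2 * vS ^ 2 +
        4 * ζ * ((N + 1 : ℕ) : ℝ) ^ 2 * C ^ 2 * vS ^ 2) := by
    rw [hmean]
    refine h2.trans ?_
    have hv2 : (volume D).toReal ^ 2 ≤ vS ^ 2 := pow_le_pow_left₀ hv0 hv 2
    have hn : (0 : ℝ) ≤ ((N + 1 : ℕ) : ℝ) := by positivity
    gcongr
  linarith [hsplit, h1, h2']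

end Literature.MathematicalPhysics.KineticTheory

end
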